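import Summits.QuantumFields.YangMills.Theorems.BalabanLadderROTUVExtract
import HarnessLib

/-!
# Route `F4SubCurvatureDoor`, crux `SubCurvatureKernel` ⟨stmt-QuantumFields-23036⟩ — the density bound of an off-diagonal limit point
# WITH ITS EXPLICIT `δ`-DEPENDENCE (`B(δ) = (C κ(δ)⁴)ⁿ`, `κ(δ) = 24/δ + 2/ℓ₄ + 24`)

Helper file (`--supports stmt-QuantumFields-23036 --as helper`; free-hands seat `ym-line-frs-p2` g17, clause (K) of the soft-half scope, HOME INBOX
2026-08-29T16:34:27Z).  Definition-free, 0 sorry, standard axioms.  No item is closed; no summit, no crux and no mass gap is proved by this file.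

WHY.  `OffDiagDensity S₁` (clause 2 of `OffDiagLimitAlong`) hides the density constant behind `∃ B`; the representation clause of
`SubCurvatureKernel` quantifies over ALL compactly supported off-diagonal test functions — supports may touch the diagonal — so integrability of
`K(x₀ − x₁) F(x)` needs HOW the constant grows as `δ ↓ 0`.  The proof of ✓`offDiagDensity_of_tendsto_latticeDist` (fleet lead `ym-spine-20042-p1`,
toolkit of ✓`stub_density`) already produces the explicit constant `(C κ⁴)ⁿ`, `κ = 24/δ + 2/ℓ₄ + 24`, with `C, ℓ₄` from `MomentBounds` and
INDEPENDENT of `δ` and `n`; this file re-runs that proof with the constant EXPOSED: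

* `norm_le_explicit_of_tendsto_latticeDist` — for any sequential limit of the centred lattice distributions along lattices in the scheme's
  ranges under `MomentBounds6`: `∃ C ℓ₄ > 0` such that for every `n ≥ 2`, `δ > 0` and compactly supported `F` supported in `Separated n δ`,
  `‖S₁ n F‖ ≤ (C (24/δ + 2/ℓ₄ + 24)⁴)ⁿ ∫ ‖F‖` — polynomial growth `≍ δ^{-4n}` (for `n = 2`: `δ⁻⁸`, the sub-curvature scale);
* `norm_le_explicit_of_offDiagLimitAlong` — the same for every off-diagonal limit point of an admissible leg scheme.

HONEST LABEL: bookkeeping toward clause (K) of the SOFT half of ⟨23036⟩; ⟨23036⟩ is an open problem (AF clause untouched); the Yang–Mills mass gap is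
NOT proved; no summit is proved by a line.
-/

set_option autoImplicit false

noncomputable section

open scoped SchwartzMap BigOperators
open MeasureTheory Filter Topology Metric
open Literature.MathematicalPhysics.QuantumFieldTheory Literature.MathematicalPhysics.QuantumLattice
open Literature.MathematicalPhysics.AQFT
open Literature.Probability.LatticeModels (box Site mem_box)
open Summit.QuantumFields.YangMills.Cruxes.OSLegsFromFemtoAndGap.DlrCollarTransfer (MomentBounds MomentBounds6)
open Summit.QuantumFields.YangMills.Cruxes.OSLegsAtWeakCouplingC.Sketch (Separated OffDiagDensity tendsto_riemann_sum)
open Summit.QuantumFields.YangMills.Theorems.OSLegsFromFemtoAndGap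
open Summit.QuantumFields.YangMills.Theorems.ROT (IsLegScheme OffDiagLimitAlong)
open Summit.QuantumFields.YangMills.Theorems.NPointIsotropy.Negative (E4)

namespace Summit.QuantumFields.YangMills.Theorems.F4SubCurvatureDoorSubCurvatureKernelExplicitDensity

variable {G : Type} [Group G] [TopologicalSpace G] [IsTopologicalGroup G] [CompactSpace G]
  [MeasurableSpace G] [BorelSpace G]

/-- ★ **EXPLICIT density bound for ANY sequential limit of the centred lattice distributions** (the constant of
✓`offDiagDensity_of_tendsto_latticeDist`, exposed): `‖S₁ n F‖ ≤ (C (24/δ + 2/ℓ₄ + 24)⁴)ⁿ ∫ ‖F‖` for `n ≥ 2`, every `δ > 0` and every compactly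
supported `F` supported in `Separated n δ`, with `C ≥ 0`, `ℓ₄ > 0` depending on `(G, r, a)` only. [folklore; Glimm–Jaffe 1987 §6.1] -/
theorem norm_le_explicit_of_tendsto_latticeDist (r : LatticeRep G) {a : ℝ → ℝ} (hMB6 : MomentBounds6 G r a)
    (as βs : ℕ → ℝ) (Ls : ℕ → ℕ) (hunits : ∀ k, as k = a (βs k)) (hβ : Tendsto βs atTop atTop)
    (hapos : ∀ k, 0 < as k) (ha0 : Tendsto as atTop (𝓝 0))
    (haL : Tendsto (fun k => as k * (Ls k : ℝ)) atTop atTop)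
    (hranges : ∀ k, 14 ≤ Ls k ∧ (as k)⁻¹ * (as k)⁻¹ ≤ Ls k)
    (S₁ : SchwingerFamily E4)
    (hconv : ∀ n, 2 ≤ n → ∀ F : 𝓢((Fin n → E4), ℂ), IsOffDiagonal F →
      Tendsto (fun k => latticeDist r.ρ (βs k) (Ls k) (as k) r.curvature.F
        (wilsonTorusMean r.ρ (βs k) (Ls k) r.curvature.F) n F) atTop (𝓝 (S₁ n F))) :
    ∃ C ℓ₄ : ℝ, 0 ≤ C ∧ 0 < ℓ₄ ∧ ∀ (N : ℕ), 2 ≤ N → ∀ δ : ℝ, 0 < δ →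
      ∀ F : 𝓢((Fin N → E4), ℂ), HasCompactSupport (F : (Fin N → E4) → ℂ) →
        tsupport (F : (Fin N → E4) → ℂ) ⊆ Separated N δ →
          ‖S₁ N F‖ ≤ (C * (24 / δ + 2 / ℓ₄ + 24) ^ 4) ^ N * ∫ x, ‖F x‖ := by
  classical
  -- adapted from `ROT.offDiagDensity_of_tendsto_latticeDist` (same toolkit, constant exposed)
  obtain ⟨C, β₄, ℓ₄, hℓ, hC, H⟩ :=
    abs_torusMoment_le_of_momentBounds r (momentBounds_of_momentBounds6 r a hMB6)
  refine ⟨C, ℓ₄, hC, hℓ, fun N hN2 δ hδ => ?_⟩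
  set κ : ℝ := 24 / δ + 2 / ℓ₄ + 24 with hκ
  have hκ0 : 0 < κ := by positivity
  intro F hFc hFs
  -- `F` is off-diagonal: its support avoids the coincidence locus
  have hFoff : IsOffDiagonal F := by
    refine IsOffDiagonal.of_tsupport_subset fun y hy hcoin => ?_
    obtain ⟨i, j, hij, hyij⟩ := (mem_coincidenceLocus y).1 hcoin
    have h : δ ≤ dist (y i) (y j) := hFs hy i j hij
    rw [hyij, dist_self] at h
    exact absurd h (not_le.2 hδ)
  -- a support radius
  obtain ⟨ρ, hρ0, hρ⟩ : ∃ ρ : ℝ, 0 ≤ ρ ∧ tsupport (F : (Fin N → EuclideanSpace ℝ (Fin 4)) → ℂ) ⊆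
      closedBall (0 : Fin N → EuclideanSpace ℝ (Fin 4)) ρ := by
    obtain ⟨ρ, hρ⟩ := hFc.isCompact.isBounded.subset_closedBall 0
    exact ⟨max ρ 0, le_max_right _ _, hρ.trans (closedBall_subset_closedBall (le_max_left _ _))⟩
  -- the two limits: lattice distributions → `S₁ N F`, Riemann sums → `∫ ‖F‖`
  have hlim : Tendsto (fun k => ‖latticeDist r.ρ (βs k) (Ls k) (as k) r.curvature.F
      (wilsonTorusMean r.ρ (βs k) (Ls k) r.curvature.F) N F‖) atTop (𝓝 ‖S₁ N F‖) :=
    (hconv N hN2 F hFoff).norm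
  have hRiem : Tendsto (fun k => as k ^ (4 * N) *
      ∑ x ∈ Fintype.piFinset (fun _ : Fin N => box 4 (Ls k)), ‖F (fun i => as k • siteToE (x i))‖)
      atTop (𝓝 (∫ y, ‖F y‖)) :=
    tendsto_riemann_sum (fun y => ‖F y‖) F.continuous.norm hFc.norm as Ls hapos ha0 haL
  -- eventual domination of the lattice distributions by the Riemann sums
  have hev : ∀ᶠ k in atTop, ‖latticeDist r.ρ (βs k) (Ls k) (as k) r.curvature.F
      (wilsonTorusMean r.ρ (βs k) (Ls k) r.curvature.F) N F‖ ≤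
      (C * κ ^ 4) ^ N * (as k ^ (4 * N) *
        ∑ x ∈ Fintype.piFinset (fun _ : Fin N => box 4 (Ls k)), ‖F (fun i => as k • siteToE (x i))‖) := by
    have hε : 0 < min (min 1 ℓ₄) (δ / 12) := lt_min (lt_min one_pos hℓ) (by positivity)
    filter_upwards [hβ.eventually_ge_atTop β₄, ha0.eventually (gt_mem_nhds hε),
      haL.eventually_ge_atTop (2 * ρ)] with k hkβ hka hkL
    have hak : 0 < as k := hapos k
    have ha1 : as k ≤ 1 := (hka.le.trans (min_le_left _ _)).trans (min_le_left _ _)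
    have haℓ : as k ≤ ℓ₄ := (hka.le.trans (min_le_left _ _)).trans (min_le_right _ _)
    have haδ : as k * 12 ≤ δ := by
      have := hka.le.trans (min_le_right _ _)
      rwa [le_div_iff₀ (by norm_num : (0 : ℝ) < 12)] at this
    obtain ⟨hL14, hLa⟩ := hranges k
    -- collar radius for the lattice separation `δ / (2 a_k) ≥ 6`
    have hδ6 : 6 ≤ δ / (2 * as k) := by
      rw [le_div_iff₀ (by positivity)]
      linarith
    obtain ⟨R, hR1, hRa, hRL, hRδ, hRinv⟩ := exists_collar_radius hδ6 hℓ hak ha1 haℓ hL14 hLa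
    have hRpos : (0 : ℝ) < R := by exact_mod_cast hR1
    have hRinv' : (R : ℝ)⁻¹ ≤ as k * κ := by
      have : 12 / (δ / (2 * as k)) + as k * (2 / ℓ₄ + 24) = as k * κ := by
        rw [hκ, div_div_eq_mul_div]
        ring
      rw [← this]
      exact hRinv
    -- the collar bound at the lattice multi-sites seen by `F`
    have hW : ∀ x : Fin N → Site 4, F (fun i => as k • siteToE (x i)) ≠ 0 →
        |torusMoment r.ρ (βs k) (Ls k) r.curvature.F
            (wilsonTorusMean r.ρ (βs k) (Ls k) r.curvature.F) x| ≤
          (C * κ ^ 4) ^ N * as k ^ (4 * N) := by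
      intro x hx
      have hy : (fun i => as k • siteToE (x i)) ∈ tsupport (F : (Fin N → EuclideanSpace ℝ (Fin 4)) → ℂ) :=
        subset_tsupport _ (Function.mem_support.2 hx)
      -- no wrap-around: all sites in the bulk of the torus
      have hwrap : ∀ i, 2 * ‖x i‖ ≤ (Ls k : ℝ) := by
        intro i
        have h1 := hρ hy
        rw [mem_closedBall, dist_zero_right] at h1
        have h2 : as k * ‖x i‖ ≤ ρ :=
          (mul_norm_le_norm_smul_siteToE hak.le (x i)).trans ((norm_le_pi_norm _ i).trans h1)
        have h3 : as k * (2 * ‖x i‖) ≤ as k * (Ls k : ℝ) := by linarith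
        exact le_of_mul_le_mul_left h3 hak
      -- lattice sup-separation `≥ δ / (2 a_k) ≥ 2R + 4`
      have hsepx : ∀ i j : Fin N, i ≠ j → 2 * (R : ℝ) + 4 ≤ ‖x i - x j‖ := by
        intro i j hij
        have h1 : δ ≤ dist (as k • siteToE (x i)) (as k • siteToE (x j)) := hFs hy i j hij
        rw [dist_eq_norm] at h1
        have h2 := norm_smul_siteToE_sub_le hak.le (x i) (x j)
        have h3 : δ / (2 * as k) ≤ ‖x i - x j‖ := by
          rw [div_le_iff₀ (by positivity)]
          linarith
        exact hRδ.trans h3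
      have hsep : ∀ i j : Fin N, i ≠ j → ∃ l : Fin 4,
          (2 * (R : ℤ) + 4) ≤ |((((x i l - x j l : ℤ) : ZMod (2 * Ls k + 1))).valMinAbs : ℤ)| := by
        intro i j hij
        obtain ⟨l, hl⟩ := exists_valMinAbs_ge_of_norm_le x hwrap i j (hsepx i j hij)
        exact ⟨l, by exact_mod_cast hl⟩
      have hRa' : (R : ℝ) * a (βs k) ≤ ℓ₄ := by
        rw [← hunits k]
        exact hRa
      have h1 := H (βs k) hkβ (Ls k) N x R hR1 hRa' hRL hsep
      have h2 : C / (R : ℝ) ^ 4 ≤ C * κ ^ 4 * as k ^ 4 := by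
        have h3 : ((R : ℝ)⁻¹) ^ 4 ≤ (as k * κ) ^ 4 :=
          pow_le_pow_left₀ (inv_nonneg.2 hRpos.le) hRinv' 4
        calc C / (R : ℝ) ^ 4 = C * ((R : ℝ)⁻¹) ^ 4 := by rw [div_eq_mul_inv, inv_pow]
          _ ≤ C * (as k * κ) ^ 4 := mul_le_mul_of_nonneg_left h3 hC
          _ = C * κ ^ 4 * as k ^ 4 := by ring
      calc _ ≤ (C / (R : ℝ) ^ 4) ^ N := h1
        _ ≤ (C * κ ^ 4 * as k ^ 4) ^ N :=
            pow_le_pow_left₀ (div_nonneg hC (pow_nonneg hRpos.le 4)) h2 N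
        _ = (C * κ ^ 4) ^ N * as k ^ (4 * N) := by rw [mul_pow, pow_mul]
    -- sum over the torus
    rw [latticeDist_apply]
    refine (norm_sum_le _ _).trans ?_
    calc ∑ x ∈ Fintype.piFinset (fun _ : Fin N => box 4 (Ls k)),
          ‖((torusMoment r.ρ (βs k) (Ls k) r.curvature.F
              (wilsonTorusMean r.ρ (βs k) (Ls k) r.curvature.F) x : ℝ) : ℂ) *
            F (fun i => as k • siteToE (x i))‖
        ≤ ∑ x ∈ Fintype.piFinset (fun _ : Fin N => box 4 (Ls k)),
          (C * κ ^ 4) ^ N * as k ^ (4 * N) * ‖F (fun i => as k • siteToE (x i))‖ := by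
          refine Finset.sum_le_sum fun x _ => ?_
          rw [norm_mul, Complex.norm_real, Real.norm_eq_abs]
          by_cases hx : F (fun i => as k • siteToE (x i)) = 0
          · simp [hx]
          · exact mul_le_mul_of_nonneg_right (hW x hx) (norm_nonneg _)
      _ = (C * κ ^ 4) ^ N * (as k ^ (4 * N) *
          ∑ x ∈ Fintype.piFinset (fun _ : Fin N => box 4 (Ls k)), ‖F (fun i => as k • siteToE (x i))‖) := by
          rw [Finset.mul_sum, Finset.mul_sum]
          exact Finset.sum_congr rfl fun x _ => by ring
  exact le_of_tendsto_of_tendsto hlim (hRiem.const_mul _) hev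

/-- **EXPLICIT density bound for off-diagonal limit points of the legs**: under `MomentBounds6`, along every admissible leg scheme and subsequence,
every `OffDiagLimitAlong` point obeys `‖S₁ n F‖ ≤ (C (24/δ + 2/ℓ₄ + 24)⁴)ⁿ ∫ ‖F‖` (`n ≥ 2`, every `δ > 0`, `F` compactly supported in
`Separated n δ`) with ONE pair `C ≥ 0`, `ℓ₄ > 0`. [folklore; Glimm–Jaffe 1987 §6.1] -/
theorem norm_le_explicit_of_offDiagLimitAlong (r : LatticeRep G) {a : ℝ → ℝ} (hMB : MomentBounds6 G r a)
    {sch : SpeciesScheme (YMSpecies G)}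
    (hsch : IsLegScheme a sch) {φ : ℕ → ℕ} (hφ : Tendsto φ atTop atTop) {S₁ : SchwingerFamily E4}
    (hS₁ : OffDiagLimitAlong r sch φ S₁) :
    ∃ C ℓ₄ : ℝ, 0 ≤ C ∧ 0 < ℓ₄ ∧ ∀ (N : ℕ), 2 ≤ N → ∀ δ : ℝ, 0 < δ →
      ∀ F : 𝓢((Fin N → E4), ℂ), HasCompactSupport (F : (Fin N → E4) → ℂ) →
        tsupport (F : (Fin N → E4) → ℂ) ⊆ Separated N δ →
          ‖S₁ N F‖ ≤ (C * (24 / δ + 2 / ℓ₄ + 24) ^ 4) ^ N * ∫ x, ‖F x‖ := by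
  obtain ⟨hunits, hβ, hranges⟩ := hsch
  obtain ⟨-, -, hconv⟩ := hS₁
  have hθ : Tendsto (fun k => φ k) atTop atTop := hφ
  exact norm_le_explicit_of_tendsto_latticeDist r hMB (fun k => sch.a (φ k)) (fun k => sch.β (φ k)) (fun k => sch.L (φ k))
    (fun k => hunits _) (hβ.comp hθ) (fun k => sch.a_pos _) (sch.tendsto_a.comp hθ) (sch.tendsto_L.comp hθ)
    (fun k => ⟨(hranges _).2.2.1, (hranges _).2.2.2⟩) S₁ hconv

end Summit.QuantumFields.YangMills.Theorems.F4SubCurvatureDoorSubCurvatureKernelExplicitDensity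

end
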